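import Literature.Geometry.Symplectic.OrigamiSphereUnfolding
import Summits.SmoothPoincare4.SmoothPoincare4.Theses.SymplecticOrigami

/-!
# SmoothPoincare4 / SymplecticOrigami — the round `S⁴` is a symplectic fold (item stmt-SmoothPoincare4-7845)

Settles the support item `RoundSphereIsOrigamiFold` of route SymplecticOrigami: the typed fold data
of the route (items `OrigamiRung` / `OrigamiFoldExistence`) are satisfiable at `M = S⁴` with
Mathlib's structure — the sanity / converse instance certifying `SPC4 ⇒ OrigamiFoldExistence`.

Witness (Cannas da Silva–Guillemin–Pires 2010, Example 2.3 / 2.6, Prop. 2.8): on the round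
`S⁴ ⊂ ℂ² × ℝ`, `V 0 = {h > 0}`, `V 1 = {h < 0}` (`upperHemisphere`, `lowerHemisphere`), fold
`Z = {h = 0}` = the equator `S³` (`equatorIncl`, a smooth embedding by
`isSmoothEmbedding_equatorIncl`); both pieces `N i = ℂℙ²` = the tree's
`Literature.Topology.FourManifolds.ComplexProjectivePlane` (charted on `EuclideanSpace ℝ (Fin 4)`)
with the Fubini–Study symplectic form `CPn.fsForm 2` (smooth, closed, non-degenerate;
`Literature/Geometry/Kaehler/ComplexProjectiveSpaceFubiniStudy.lean`); centres `S i = ℂℙ¹`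
(`ComplexProjectiveSpace 1`) embedded as the tree's line `ComplexProjectiveSpace.lineIncl`
(`[v₀ : v₁] ↦ [v₀ : v₁ : 0]`, a smooth embedding and a symplectic submanifold,
`Literature/Geometry/Kaehler/ProjectiveLineSymplectic.lean`); blow-down maps
`β i = unfoldMap : (z₁, z₂, h) ↦ [z₁ : z₂ : h]`, smooth on all of `S⁴`, injective on each open
hemisphere with image `ℂℙ² ∖ line`, a local diffeomorphism there, the Hopf map on the equator with
one-dimensional kernel of `dβ` (the Hopf direction) — all proved in
`Literature/Geometry/Symplectic/OrigamiSphereBlowDown.lean` and `OrigamiSphereUnfolding.lean`.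

References: A. Cannas da Silva, V. Guillemin, A. R. Pires, *Symplectic Origami*, IMRN 2011 =
arXiv:0909.4065, Example 2.3, Example 2.6, Prop. 2.8 [CannasdasilvaGuilleminPires2010].
-/

-- the registered namespace `Summit.SmoothPoincare4.SmoothPoincare4.Theorems` repeats a component
set_option linter.dupNamespace false

noncomputable section

open scoped Manifold ContDiff Topology
open Set Function Module
open Literature.Geometry.Kaehler Literature.Geometry.Symplectic Literature.Topology.FourManifolds
open Literature.Topology.FourManifolds.ComplexProjectiveSpace

namespace Summit.SmoothPoincare4.SmoothPoincare4.Theorems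

attribute [local instance] fact_finrank_euclideanSpace_five

/-- Settles stmt-SmoothPoincare4-7845 (`SymplecticOrigami.RoundSphereIsOrigamiFold`): the round
`S⁴ ⊂ ℂ² × ℝ` carries the route's typed fold data — `V 0 = {h > 0}`, `V 1 = {h < 0}`, connected
fold `Z = S³` (the equator), `N i = ComplexProjectivePlane` with the Fubini–Study form `CPn.fsForm 2`,
`S i = ComplexProjectiveSpace 1` embedded by the tree's `lineIncl`, `β i (z₁, z₂, h) = [z₁ : z₂ : h]`
(a diffeomorphism of each open hemisphere onto `ℂℙ² ∖ line`, the
Hopf map on the equator, `ker dβ` = the Hopf direction). Every clause is a theorem of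
`Literature/Geometry/Symplectic/OrigamiSphereUnfolding.lean` (`hemisphere_foldData` packages the
per-side clauses). [cite: CannasdasilvaGuilleminPires2010, Example 2.6] -/
theorem roundSphereIsOrigamiFold_proof :
    Summit.SmoothPoincare4.SmoothPoincare4.Theses.SymplecticOrigami.RoundSphereIsOrigamiFold := by
  unfold Summit.SmoothPoincare4.SmoothPoincare4.Theses.SymplecticOrigami.RoundSphereIsOrigamiFold
  refine ⟨![upperHemisphere, lowerHemisphere], fun _ ↦ ComplexProjectivePlane, fun _ ↦ inferInstance,
    fun _ ↦ inferInstance, fun _ ↦ inferInstance, fun _ ↦ inferInstance, fun _ ↦ inferInstance,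
    fun _ ↦ inferInstance, fun _ ↦ inferInstance, fun _ ↦ CPn.fsForm 2,
    fun _ ↦ ComplexProjectiveSpace 1, fun _ ↦ inferInstance, fun _ ↦ inferInstance,
    fun _ ↦ inferInstance, fun _ ↦ inferInstance, fun _ ↦ inferInstance, fun _ ↦ lineIncl,
    fun _ ↦ unfoldMap, ?_, ?_⟩
  · refine ⟨disjoint_hemispheres, ?_, isConnected_compl_hemispheres, ?_⟩
    · exact Fin.forall_fin_two.2
        ⟨⟨_, northPole_mem_upperHemisphere⟩, ⟨_, neg_northPole_mem_lowerHemisphere⟩⟩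
    · exact ⟨Metric.sphere (0 : EuclideanSpace ℝ (Fin 4)) 1, inferInstance, inferInstance,
        inferInstance, equatorIncl, isSmoothEmbedding_equatorIncl,
        compl_union_hemispheres_eq_range.symm⟩
  · intro i
    have hV : (![upperHemisphere, lowerHemisphere] :
          Fin 2 → TopologicalSpace.Opens (Metric.sphere (0 : EuclideanSpace ℝ (Fin 5)) 1)) i =
          upperHemisphere ∨
        (![upperHemisphere, lowerHemisphere] :
          Fin 2 → TopologicalSpace.Opens (Metric.sphere (0 : EuclideanSpace ℝ (Fin 5)) 1)) i =
          lowerHemisphere := by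
      fin_cases i <;> simp
    obtain ⟨h1, h2, h3, h4, h5, h6⟩ := hemisphere_foldData _ hV
    exact ⟨CPn.isSmoothForm_fsForm, CPn.isClosedForm_fsForm, CPn.fsForm_nondegenerate,
      CPn.isSmoothEmbedding_lineIncl, CPn.fsForm_lineIncl_ne_zero, h1, h2, h3, h4, h5, h6⟩

end Summit.SmoothPoincare4.SmoothPoincare4.Theorems
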